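import Literature.NumberTheory.NumberFields.NFIsoNormPoly
import Literature.Computability.Complexity.IrreducibilityLLLPolyArithFP
import Literature.Computability.Complexity.CodeFPListKit
import Literature.Computability.Complexity.CodeFPBudgets
import Literature.Computability.Complexity.CodeFPFinite
import HarnessLib

/-!
# The norm polynomial of Trager's method is computable in polynomial time (`CodeFP`)

Support file for the discharge of the named fact
`Literature.NumberTheory.NumberFields.nfIso_mem_P` (number-field isomorphism is in `P`;
Landau 1985, A. K. Lenstra 1983 Thm. (3.7)). Machine side of `NFIsoResultant.lean` and
`NFIsoNormPoly.lean`: the list programs there are computed on codes by polynomial-time string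
functions, in the typed `FP` algebra `CodeFP` (`CodeFP*.lean`; coefficient lists are `rawE intE`,
formal degrees and the number of nodes UNARY — the Sylvester matrix has `(m + n)²` entries and the
interpolation `D + 1` nodes, so these parameters must be polynomially bounded in value, which they
are in the isomorphism test: `m, n ≤` the input length, `D = m n`). Every loop is a `map`/`filter`
over a range or the tree's folds `psumC`/`pprodC`/`detZ_codeFP`, so no accumulator estimate is
needed here:

* `pcompLinAlt` (`= Σ_k p_k (x₀ − cY)^k` by `mapIdx`, same polynomial as `pcompLin`:
  `ofCoeffs_pcompLinAlt`), `pcompLinAltC`; `sylvRowsC`, **`resValC`** (the integer resultant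
  `Res_Y(q(Y), p(t − cY))` through `IntDetFP.detZ_codeFP`);
* `iprod` (integer products through `pprod` of constant polynomials), `facZ = D!`, `denomZ`,
  `lagScalarAlt = D! / ∏_{j ≠ i}(i − j)` (`= lagScalar`, `lagScalarAlt_eq`), `lagNumerC`,
  `interpMulC`, `interpC`, and **`normPolyC`**:
  `((pl, ql), (c, (m, n))) ↦ normPoly pl ql c m n` on codes.

## References

* S. Arora, B. Barak, *Computational Complexity: A Modern Approach*, CUP 2009, §1.3 (polynomial
  time is closed under composition and polynomially bounded loops). [AroraBarak2009]
* H. Cohen, *A Course in Computational Algebraic Number Theory*, GTM 138, 1993, §3.3.2, §3.6.2,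
  Alg. 3.6.4. [Cohen1993]
* S. Landau, SIAM J. Comput. 14 (1985), §1 (Thm. 1.4). [Landau1985]
-/

open Polynomial Finset

namespace Literature.NumberTheory.NumberFields

open Literature.Computability.Complexity Literature.Computability.Complexity.CodeFP
open Literature.Computability.Complexity.SumcheckMA Literature.Computability.Complexity.LLLFactoring
open scoped Nat

/-- The encoder of coefficient lists. -/
local notation "L" => rawE intE

/-- Indexing an integer list with default `0`. [folklore] -/
theorem getD0C : CodeFP (pairE L natE) intE (fun p => p.1.getD p.2 0) :=
  ((rawGetOr intE).comp ((fst _ _).pair ((snd _ _).pair (const _ (0 : ℤ))))).congr fun _ => rfl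

/-- Head of an integer list with default `0`. [folklore] -/
theorem headD0C : CodeFP L intE (fun l => l.headD 0) :=
  ((rawHeadOr intE).comp ((const _ (0 : ℤ)).pair (CodeFP.id _))).congr fun _ => rfl

/-! ### `p(x₀ − cY)` by combinators -/

/-- `p(x₀ − cY) = Σ_k p_k (x₀ − cY)^k`, computed row by row (`mapIdx`) and summed (`psum`).
[cite: Cohen1993, Alg. 3.6.4 step 3] -/
def pcompLinAlt (p : List ℤ) (x0 c : ℤ) : List ℤ :=
  psum (p.mapIdx fun k a => pscale a (pprod (List.replicate k [x0, -c])))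

/-- Powers on lists. [folklore] -/
theorem ofCoeffs_pprod_replicate (k : ℕ) (lin : List ℤ) :
    ofCoeffs (pprod (List.replicate k lin)) = ofCoeffs lin ^ k := by
  rw [ofCoeffs_pprod, List.map_replicate, List.prod_replicate]

/-- **`pcompLinAlt` computes the substitution** `p(x₀ − cX)` (the same polynomial as `pcompLin`).
[cite: Cohen1993, Alg. 3.6.4 step 3] -/
theorem ofCoeffs_pcompLinAlt (p : List ℤ) (x0 c : ℤ) :
    ofCoeffs (pcompLinAlt p x0 c) = (ofCoeffs p).comp (C x0 - C c * X) := by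
  rw [pcompLinAlt, ofCoeffs_psum]
  have hlist : (p.mapIdx fun k a => pscale a (pprod (List.replicate k [x0, -c]))).map ofCoeffs =
      (List.range p.length).map fun k => C (p.getD k 0) * (C x0 - C c * X) ^ k := by
    refine List.ext_getElem (by simp) fun k h₁ h₂ => ?_
    rw [List.getElem_map, List.getElem_mapIdx, List.getElem_map, List.getElem_range, ofCoeffs_pscale,
      ofCoeffs_pprod_replicate, ofCoeffs_lin, List.getD_eq_getElem _ _ (by simpa using h₁)]
  rw [hlist, list_sum_range_map]
  by_cases hp : p = []
  · subst hp; simp [ofCoeffs]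
  · have hdeg : (ofCoeffs p).natDegree < p.length := by
      have := natDegree_ofCoeffs_le p
      have := List.length_pos_of_ne_nil hp
      omega
    rw [Polynomial.comp, eval₂_eq_sum_range' C hdeg]
    exact Finset.sum_congr rfl fun k _ => by rw [coeff_ofCoeffs]

/-- `resVal` depends on `gl` only through its polynomial. [folklore] -/
theorem resVal_congr_right (fl : List ℤ) {gl gl' : List ℤ} (h : ofCoeffs gl = ofCoeffs gl') (m n : ℕ) :
    resVal fl gl m n = resVal fl gl' m n := by
  rw [resVal_eq, resVal_eq, h]

/-- **`pcompLinAlt` on codes**: `((x₀, c), p) ↦ p(x₀ − cY)` (rows `p_k · [x₀, −c]^k` by `mapIdx` with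
the unary budget `|p| ≥ k` for the power, then `psum`). [cite: AroraBarak2009, §1.3] -/
theorem pcompLinAltC : CodeFP (pairE (pairE intE intE) L) L (fun t => pcompLinAlt t.2 t.1.1 t.1.2) := by
  -- context `(lin, 1^{|p|})`, item `(k, a)`
  have hlin : CodeFP (pairE (pairE L unE) (pairE natE intE)) L (fun t => t.1.1) := (fst _ _).fst'
  have hcap : CodeFP (pairE (pairE L unE) (pairE natE intE)) unE (fun t => t.1.2) := (fst _ _).snd'
  have hk : CodeFP (pairE (pairE L unE) (pairE natE intE)) natE (fun t => t.2.1) := (snd _ _).fst'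
  have ha : CodeFP (pairE (pairE L unE) (pairE natE intE)) intE (fun t => t.2.2) := (snd _ _).snd'
  have hrow : CodeFP (pairE (pairE L unE) (pairE natE intE)) L
      (fun t => pscale t.2.2 (pprod (List.replicate (min t.2.1 t.1.2) t.1.1))) :=
    (pscaleC.comp (ha.pair (pprodC.comp ((replicateOf L).comp (hlin.pair (unOfNatMin.comp (hcap.pair hk)))))) :)
  have hm := mapIdx (σ := List ℤ × ℕ) (eσ := pairE L unE)
    (g := fun t : (List ℤ × ℕ) × ℕ × ℤ => pscale t.2.2 (pprod (List.replicate (min t.2.1 t.1.2) t.1.1))) hrow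
  have hlin0 : CodeFP (pairE (pairE intE intE) L) L (fun t => [t.1.1, -t.1.2]) :=
    ((rawCons intE).comp ((fst _ _).fst'.pair ((rawSingleton intE).comp (intNeg.comp (fst _ _).snd'))) :)
  have hall : CodeFP (pairE (pairE intE intE) L) (rawE L)
      (fun t => t.2.mapIdx fun k a => pscale a (pprod (List.replicate (min k t.2.length) [t.1.1, -t.1.2]))) :=
    (hm.comp ((hlin0.pair ((ulength intE).comp (snd _ _))).pair (snd _ _)) :)
  refine ((psumC.comp hall).congr fun t => ?_)
  unfold pcompLinAlt
  congr 1
  apply List.ext_getElem (by simp)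
  intro i h1 h2
  rw [List.getElem_mapIdx, List.getElem_mapIdx, min_eq_left]
  rw [List.length_mapIdx] at h1
  exact h1.le

/-! ### The Sylvester rows and the resultant on codes -/

/-- The Sylvester entry with Boolean tests (the shape `CodeFP.ite` produces). [folklore] -/
def sylvEntryB (fl gl : List ℤ) (m n i j : ℕ) : ℤ :=
  if decide (j < m) = true then
    (if (decide (j ≤ i) && decide (i ≤ j + n)) = true then gl.getD (i - j) 0 else 0)
  else (if (decide (j - m ≤ i) && decide (i ≤ j - m + m)) = true then fl.getD (i - (j - m)) 0 else 0)

/-- `sylvEntryB = sylvEntryL`. [folklore] -/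
theorem sylvEntryB_eq (fl gl : List ℤ) (m n i j : ℕ) : sylvEntryB fl gl m n i j = sylvEntryL fl gl m n i j := by
  unfold sylvEntryB sylvEntryL
  simp only [Bool.and_eq_true, decide_eq_true_eq]

/-- **The Sylvester rows on codes**: `((fl, gl), (1^m, 1^n)) ↦ sylvRows fl gl m n` (two nested maps
over the unary range `m + n`). [cite: AroraBarak2009, §1.3] [cite: Cohen1993, §3.3.2] -/
theorem sylvRowsC : CodeFP (pairE (pairE L L) (pairE unE unE)) (rawE L)
    (fun t => sylvRows t.1.1 t.1.2 t.2.1 t.2.2) := by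
  -- the entry, in the context `(((fl, gl), (m, n)), i)` with item `j`
  have hfl : CodeFP (pairE (pairE (pairE (pairE L L) (pairE unE unE)) natE) natE) L (fun q => q.1.1.1.1) :=
    (fst _ _).fst'.fst'.fst'
  have hgl : CodeFP (pairE (pairE (pairE (pairE L L) (pairE unE unE)) natE) natE) L (fun q => q.1.1.1.2) :=
    (fst _ _).fst'.fst'.snd'
  have hm : CodeFP (pairE (pairE (pairE (pairE L L) (pairE unE unE)) natE) natE) natE (fun q => q.1.1.2.1) :=
    natOfUn.comp (fst _ _).fst'.snd'.fst'
  have hn : CodeFP (pairE (pairE (pairE (pairE L L) (pairE unE unE)) natE) natE) natE (fun q => q.1.1.2.2) :=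
    natOfUn.comp (fst _ _).fst'.snd'.snd'
  have hi : CodeFP (pairE (pairE (pairE (pairE L L) (pairE unE unE)) natE) natE) natE (fun q => q.1.2) :=
    (fst _ _).snd'
  have hj : CodeFP (pairE (pairE (pairE (pairE L L) (pairE unE unE)) natE) natE) natE (fun q => q.2) := snd _ _
  have c1 : CodeFP (pairE (pairE (pairE (pairE L L) (pairE unE unE)) natE) natE) bitE
      (fun q => decide (q.2 < q.1.1.2.1)) := (natLt.comp (hj.pair hm) :)
  have c2 : CodeFP (pairE (pairE (pairE (pairE L L) (pairE unE unE)) natE) natE) bitE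
      (fun q => decide (q.2 ≤ q.1.2) && decide (q.1.2 ≤ q.2 + q.1.1.2.2)) :=
    ((natLe.comp (hj.pair hi)).and (natLe.comp (hi.pair (natAdd.comp (hj.pair hn)))) :)
  have v1 : CodeFP (pairE (pairE (pairE (pairE L L) (pairE unE unE)) natE) natE) intE
      (fun q => q.1.1.1.2.getD (q.1.2 - q.2) 0) := (getD0C.comp (hgl.pair (natSub.comp (hi.pair hj))) :)
  have c3 : CodeFP (pairE (pairE (pairE (pairE L L) (pairE unE unE)) natE) natE) bitE
      (fun q => decide (q.2 - q.1.1.2.1 ≤ q.1.2) && decide (q.1.2 ≤ q.2 - q.1.1.2.1 + q.1.1.2.1)) :=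
    ((natLe.comp ((natSub.comp (hj.pair hm)).pair hi)).and
      (natLe.comp (hi.pair (natAdd.comp ((natSub.comp (hj.pair hm)).pair hm)))) :)
  have v2 : CodeFP (pairE (pairE (pairE (pairE L L) (pairE unE unE)) natE) natE) intE
      (fun q => q.1.1.1.1.getD (q.1.2 - (q.2 - q.1.1.2.1)) 0) :=
    (getD0C.comp (hfl.pair (natSub.comp (hi.pair (natSub.comp (hj.pair hm))))) :)
  have hentry : CodeFP (pairE (pairE (pairE (pairE L L) (pairE unE unE)) natE) natE) intE
      (fun q => sylvEntryB q.1.1.1.1 q.1.1.1.2 q.1.1.2.1 q.1.1.2.2 q.1.2 q.2) :=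
    ((c1.ite (c2.ite v1 (const _ 0)) (c3.ite v2 (const _ 0))).congr fun q => by rfl)
  -- the row `i`
  have hrange1 : CodeFP (pairE (pairE (pairE L L) (pairE unE unE)) natE) (rawE natE) (fun r => List.range (r.1.2.1 + r.1.2.2)) :=
    (urange.comp (unAdd.comp ((fst _ _).snd'.fst'.pair (fst _ _).snd'.snd')) :)
  have hrow : CodeFP (pairE (pairE (pairE L L) (pairE unE unE)) natE) L
      (fun r => (List.range (r.1.2.1 + r.1.2.2)).map fun j => sylvEntryB r.1.1.1 r.1.1.2 r.1.2.1 r.1.2.2 r.2 j) :=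
    ((map hentry).comp ((CodeFP.id _).pair hrange1) :)
  have hrange0 : CodeFP (pairE (pairE L L) (pairE unE unE)) (rawE natE) (fun t => List.range (t.2.1 + t.2.2)) :=
    (urange.comp (unAdd.comp ((snd _ _).fst'.pair (snd _ _).snd')) :)
  have hall : CodeFP (pairE (pairE L L) (pairE unE unE)) (rawE L)
      (fun t => (List.range (t.2.1 + t.2.2)).map fun i =>
        (List.range (t.2.1 + t.2.2)).map fun j => sylvEntryB t.1.1 t.1.2 t.2.1 t.2.2 i j) :=
    ((map hrow).comp ((CodeFP.id _).pair hrange0) :)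
  refine hall.congr fun t => ?_
  unfold sylvRows
  simp only [sylvEntryB_eq]

/-- **The integer resultant `Res(ofCoeffs fl, ofCoeffs gl)` (formal degrees `1^m, 1^n`) on codes**,
through the tree's polynomial-time determinant `IntDetFP.detZ_codeFP` (Berkowitz). [cite: Cohen1993, §3.3.2] [cite: AroraBarak2009, §1.3] -/
theorem resValC : CodeFP (pairE (pairE L L) (pairE unE unE)) intE (fun t => resVal t.1.1 t.1.2 t.2.1 t.2.2) :=
  (IntDetFP.detZ_codeFP.comp sylvRowsC).congr fun _ => rfl

/-! ### Integer products, factorials and the Lagrange scalars on codes -/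

/-- The product of a list of integers, through `pprod` of constant polynomials. [folklore] -/
def iprod (l : List ℤ) : ℤ := (pprod (l.map fun z => [z])).headD 0

/-- `pmul` of two constants. [folklore] -/
theorem pmul_singleton (a b : ℤ) : pmul [a] [b] = [a * b] := by
  simp [pmul, psum, prows, pshift, pscale, padd, CodeFP.zipWithPad]

/-- `pprod` of constants is the constant product. [folklore] -/
theorem pprod_map_singleton (l : List ℤ) : pprod (l.map fun z => [z]) = [l.prod] := by
  suffices h : ∀ x : ℤ, (l.map fun z => [z]).foldl (fun acc p => pmul acc p) [x] = [x * l.prod] by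
    have := h 1; rw [one_mul] at this; exact this
  induction l with
  | nil => intro x; simp
  | cons z l ih =>
    intro x
    rw [List.map_cons, List.foldl_cons, pmul_singleton, ih, List.prod_cons, mul_assoc]

/-- `iprod l = ∏ l`. [folklore] -/
theorem iprod_eq (l : List ℤ) : iprod l = l.prod := by
  rw [iprod, pprod_map_singleton]; rfl

/-- **Integer products on codes.** [cite: AroraBarak2009, §1.3] -/
theorem iprodC : CodeFP L intE iprod :=
  (headD0C.comp (pprodC.comp (map₀ (rawSingleton intE)))).congr fun _ => rfl

/-- `D!` as an integer product. [folklore] -/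
def facZ (D : ℕ) : ℤ := iprod ((List.range D).map fun j : ℕ => (j : ℤ) + 1)

/-- `facZ D = D!`. [folklore] -/
theorem facZ_eq (D : ℕ) : facZ D = (D ! : ℤ) := by
  rw [facZ, iprod_eq]
  induction D with
  | zero => simp
  | succ D ih =>
    rw [List.range_succ, List.map_append, List.prod_append, ih, Nat.factorial_succ]
    simp
    ring

/-- **`D!` on codes** (`D` unary). [cite: AroraBarak2009, §1.3] -/
theorem facZC : CodeFP unE intE facZ :=
  (iprodC.comp ((map₀ (g := fun j : ℕ => (j : ℤ) + 1) (intAdd.comp (intOfNat.pair (const _ (1 : ℤ))))).comp urange)).congr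
    fun _ => rfl

/-- The Lagrange denominator `∏_{j ≤ D, j ≠ i} (i − j)` as an integer product. [cite: KnuthTAOCP2, §4.6.4] -/
def denomZ (D i : ℕ) : ℤ := iprod ((((List.range (D + 1)).filter fun j => decide (j ≠ i))).map fun j : ℕ => (i : ℤ) - j)

/-- `denomZ` as the `Finset` product of `NFIsoNormPoly.prod_sub_eq`. [folklore] -/
theorem denomZ_eq (D i : ℕ) : denomZ D i = ∏ j ∈ (range (D + 1)).filter (fun j => j ≠ i), ((i : ℤ) - j) := by
  rw [denomZ, iprod_eq, list_prod_filter_range_map]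

/-- **The denominators on codes** (`D` unary, `i` binary). [cite: AroraBarak2009, §1.3] -/
theorem denomZC : CodeFP (pairE unE natE) intE (fun t => denomZ t.1 t.2) := by
  have hfilt : CodeFP (pairE natE (rawE natE)) (rawE natE) (fun q => q.2.filter fun j => !decide (j = q.1)) :=
    (filter (σ := ℕ) (eσ := natE) (p := fun t : ℕ × ℕ => !decide (t.2 = t.1)) ((natEq.comp ((snd _ _).pair (fst _ _))).not) :)
  have hmap : CodeFP (pairE natE (rawE natE)) L (fun q => q.2.map fun j : ℕ => (q.1 : ℤ) - j) :=
    (map (σ := ℕ) (eσ := natE) (g := fun t : ℕ × ℕ => (t.1 : ℤ) - t.2) (intSub.comp ((intOfNat.comp (fst _ _)).pair (intOfNat.comp (snd _ _)))) :)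
  have h : CodeFP (pairE unE natE) intE
      (fun t => iprod (((List.range (t.1 + 1)).filter fun j => !decide (j = t.2)).map fun j : ℕ => (t.2 : ℤ) - j)) :=
    (iprodC.comp (hmap.comp ((snd _ _).pair (hfilt.comp ((snd _ _).pair (urange.comp (unSucc.comp (fst _ _))))))) :)
  refine h.congr fun t => ?_
  unfold denomZ
  congr 2
  exact List.filter_congr fun j _ => by simp

/-- The Lagrange scalar as an exact integer quotient `D! / ∏_{j ≠ i} (i − j)`. [cite: KnuthTAOCP2, §4.6.4] -/
def lagScalarAlt (D i : ℕ) : ℤ := facZ D / denomZ D i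

/-- `lagScalarAlt D i = lagScalar D i` for the nodes `i ≤ D` (`NFIsoNormPoly.lagScalar_mul_prod_sub`). [cite: KnuthTAOCP2, §4.6.4] -/
theorem lagScalarAlt_eq {D i : ℕ} (hi : i ≤ D) : lagScalarAlt D i = lagScalar D i := by
  rw [lagScalarAlt, facZ_eq, denomZ_eq]
  have hne : ∏ j ∈ (range (D + 1)).filter (fun j => j ≠ i), ((i : ℤ) - j) ≠ 0 := by
    rw [Finset.prod_ne_zero_iff]
    intro j hj
    have := (mem_filter.1 hj).2
    omega
  exact Int.ediv_eq_of_eq_mul_left hne (lagScalar_mul_prod_sub hi).symm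

/-- **The Lagrange scalars on codes.** [cite: AroraBarak2009, §1.3] -/
theorem lagScalarAltC : CodeFP (pairE unE natE) intE (fun t => lagScalarAlt t.1 t.2) :=
  (intEDiv.comp ((facZC.comp (fst _ _)).pair denomZC)).congr fun _ => rfl

/-- **The Lagrange numerators on codes** (`D` unary, `i` binary). [cite: AroraBarak2009, §1.3] -/
theorem lagNumerC : CodeFP (pairE unE natE) L (fun t => lagNumer t.1 t.2) := by
  have hfilt : CodeFP (pairE natE (rawE natE)) (rawE natE) (fun q => q.2.filter fun j => !decide (j = q.1)) :=
    (filter (σ := ℕ) (eσ := natE) (p := fun t : ℕ × ℕ => !decide (t.2 = t.1)) ((natEq.comp ((snd _ _).pair (fst _ _))).not) :)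
  have hitem : CodeFP natE L (fun j : ℕ => [-(j : ℤ), 1]) :=
    ((rawCons intE).comp ((intNeg.comp intOfNat).pair (const _ [(1 : ℤ)])) :)
  have h : CodeFP (pairE unE natE) L
      (fun t => pprod ((((List.range (t.1 + 1)).filter fun j => !decide (j = t.2))).map fun j : ℕ => [-(j : ℤ), 1])) :=
    (pprodC.comp ((map₀ hitem).comp (hfilt.comp ((snd _ _).pair (urange.comp (unSucc.comp (fst _ _)))))) :)
  refine h.congr fun t => ?_
  unfold lagNumer
  congr 2
  exact List.filter_congr fun j _ => by simp

/-! ### The interpolation and the norm polynomial on codes -/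

/-- `D! · N` with the scalars as quotients. [cite: KnuthTAOCP2, §4.6.4] -/
def interpMulAlt (D : ℕ) (v : List ℤ) : List ℤ :=
  psum ((List.range (D + 1)).map fun i => pscale (v.getD i 0 * lagScalarAlt D i) (lagNumer D i))

/-- `interpMulAlt = interpMul` (the scalars agree on the nodes). [folklore] -/
theorem interpMulAlt_eq (D : ℕ) (v : List ℤ) : interpMulAlt D v = interpMul D v := by
  unfold interpMulAlt interpMul
  congr 1
  refine List.map_congr_left fun i hi => ?_
  rw [lagScalarAlt_eq (Nat.lt_succ_iff.1 (List.mem_range.1 hi))]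

/-- **`D! · N` on codes** (`D` unary, values `v`). [cite: AroraBarak2009, §1.3] -/
theorem interpMulC : CodeFP (pairE unE L) L (fun t => interpMul t.1 t.2) := by
  have hD : CodeFP (pairE (pairE unE L) natE) unE (fun q => q.1.1) := (fst _ _).fst'
  have hv : CodeFP (pairE (pairE unE L) natE) L (fun q => q.1.2) := (fst _ _).snd'
  have hi : CodeFP (pairE (pairE unE L) natE) natE (fun q => q.2) := snd _ _
  have hitem : CodeFP (pairE (pairE unE L) natE) L
      (fun q => pscale (q.1.2.getD q.2 0 * lagScalarAlt q.1.1 q.2) (lagNumer q.1.1 q.2)) :=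
    (pscaleC.comp ((intMul.comp ((getD0C.comp (hv.pair hi)).pair (lagScalarAltC.comp (hD.pair hi)))).pair
      (lagNumerC.comp (hD.pair hi))) :)
  have h : CodeFP (pairE unE L) L
      (fun t => psum ((List.range (t.1 + 1)).map fun i => pscale (t.2.getD i 0 * lagScalarAlt t.1 i) (lagNumer t.1 i))) :=
    (psumC.comp ((map hitem).comp ((CodeFP.id _).pair (urange.comp (unSucc.comp (fst _ _))))) :)
  exact h.congr fun t => interpMulAlt_eq t.1 t.2

/-- **The interpolant on codes**: exact division by `D!`. [cite: AroraBarak2009, §1.3] -/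
theorem interpC : CodeFP (pairE unE L) L (fun t => interp t.1 t.2) := by
  have hdiv : CodeFP (pairE unE intE) intE (fun q => q.2 / facZ q.1) := (intEDiv.comp ((snd _ _).pair (facZC.comp (fst _ _))) :)
  have h : CodeFP (pairE unE L) L (fun t => (interpMul t.1 t.2).map fun x => x / facZ t.1) :=
    ((map hdiv).comp ((fst _ _).pair interpMulC) :)
  refine h.congr fun t => ?_
  unfold interp
  simp only [facZ_eq]

/-- `n · m` in unary from `1^m`, `1^n`. [folklore] -/
theorem unMulC : CodeFP (pairE unE unE) unE (fun t => t.2 * t.1) :=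
  ((ulength unitE).comp (unitsMul.comp ((replicateUnit.comp (snd _ _)).pair (replicateUnit.comp (fst _ _))))).congr
    fun t => by simp

/-- **The norm polynomial on codes**: `((pl, ql), (c, (1^m, 1^n))) ↦ normPoly pl ql c m n` — the
`n m + 1` integer resultants `Res_Y(q(Y), p(t − cY))` by `resValC`, then `interpC`.
[cite: Cohen1993, Alg. 3.6.4 step 3] [cite: Landau1985, §1 (Thm. 1.4)] [cite: AroraBarak2009, §1.3] -/
theorem normPolyC : CodeFP (pairE (pairE L L) (pairE intE (pairE unE unE))) L
    (fun t => normPoly t.1.1 t.1.2 t.2.1 t.2.2.1 t.2.2.2) := by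
  -- context `t`, item the node `x : ℕ`
  have hpl : CodeFP (pairE (pairE (pairE L L) (pairE intE (pairE unE unE))) natE) L (fun q => q.1.1.1) := (fst _ _).fst'.fst'
  have hql : CodeFP (pairE (pairE (pairE L L) (pairE intE (pairE unE unE))) natE) L (fun q => q.1.1.2) := (fst _ _).fst'.snd'
  have hc : CodeFP (pairE (pairE (pairE L L) (pairE intE (pairE unE unE))) natE) intE (fun q => q.1.2.1) := (fst _ _).snd'.fst'
  have hm : CodeFP (pairE (pairE (pairE L L) (pairE intE (pairE unE unE))) natE) unE (fun q => q.1.2.2.1) := (fst _ _).snd'.snd'.fst'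
  have hn : CodeFP (pairE (pairE (pairE L L) (pairE intE (pairE unE unE))) natE) unE (fun q => q.1.2.2.2) := (fst _ _).snd'.snd'.snd'
  have hx : CodeFP (pairE (pairE (pairE L L) (pairE intE (pairE unE unE))) natE) intE (fun q => (q.2 : ℤ)) := intOfNat.comp (snd _ _)
  have hval : CodeFP (pairE (pairE (pairE L L) (pairE intE (pairE unE unE))) natE) intE
      (fun q => resVal q.1.1.2 (pcompLinAlt q.1.1.1 (q.2 : ℤ) q.1.2.1) q.1.2.2.1 q.1.2.2.2) :=
    (resValC.comp ((hql.pair (pcompLinAltC.comp ((hx.pair hc).pair hpl))).pair (hm.pair hn)) :)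
  have hD : CodeFP (pairE (pairE L L) (pairE intE (pairE unE unE))) unE (fun t => t.2.2.2 * t.2.2.1) :=
    (unMulC.comp (snd _ _).snd' :)
  have hvals : CodeFP (pairE (pairE L L) (pairE intE (pairE unE unE))) L
      (fun t => (List.range (t.2.2.2 * t.2.2.1 + 1)).map fun x : ℕ =>
        resVal t.1.2 (pcompLinAlt t.1.1 (x : ℤ) t.2.1) t.2.2.1 t.2.2.2) :=
    ((map hval).comp ((CodeFP.id _).pair (urange.comp (unSucc.comp hD))) :)
  have h := interpC.comp (hD.pair hvals)
  refine h.congr fun t => ?_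
  show interp (t.2.2.2 * t.2.2.1) _ = normPoly t.1.1 t.1.2 t.2.1 t.2.2.1 t.2.2.2
  unfold normPoly
  congr 1
  refine List.map_congr_left fun x _ => ?_
  exact resVal_congr_right _ (by rw [ofCoeffs_pcompLinAlt, ofCoeffs_pcompLin]) _ _

end Literature.NumberTheory.NumberFields
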